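import Literature.Barriers.QuantumAdvantage.AaronsonChenPHWindow
import Literature.Barriers.QuantumAdvantage.AaronsonChenPHUpper
import Literature.Computability.Complexity.RandomOraclePHProofs
import Literature.Computability.Complexity.AverageCaseDepthHierarchyThm1
import HarnessLib

/-!
# `Sipser_{k+3} ∘ OR` escapes `Σₖ^{A ⊕ O}` for `𝒟_O`-almost every `O` (discharge of `sipserOrLang_ae_not_mem_sigmaPRel`); Aaronson–Chen 2017, Thm. 5.1, second half, PROVED

Proof file (D-0014: theorems and concrete definitions only) for the named fact
`Literature.Barriers.QuantumAdvantage.sipserOrLang_ae_not_mem_sigmaPRel` of `AaronsonChenPH.lean`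
(S. Aaronson, L. Chen, CCC 2017, arXiv:1612.05903 [AaronsonChen2017], §5.4 p. 24: the content
of the second half of **Thm. 5.1**, "`PH^{TQBF,O}` is infinite with probability `1` when
`O ∼ 𝒟_O`"), announced by the sibling files `AaronsonChenPHLemma55.lean`,
`AaronsonChenPHMeasure.lean`, `AaronsonChenPHWindow.lean` as `AaronsonChenPHLowerBound.lean`.

**The printed proof** (§5.4, p. 24): Thm. 5.4 = Rossman–Servedio–Tan's average-case depth
hierarchy theorem (in the tree: `rossmanServedioTan2015_thm1_inRegime`, PROVED as
`rossmanServedioTan2015_thm1_inRegime_holds`, `AverageCaseDepthHierarchyThm1.lean`); Lemma 5.5: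
`Sipser_d ∘ OR` on `{0,1}^{N²}` is hard on average for depth-`(d-1)` circuits of size
`2^{N^{1/(6(d-1))}}` when the inputs are drawn from `𝒟_n` (averaging over the hidden positions
and projecting: `lemma55_finite`, `AaronsonChenPHLemma55.lean`); "it is easy to see that it has
a polynomial-size circuit (in fact, a formula) of depth `d + 1`; and by Lemma 5.5, every
polynomial size circuit of depth `d - 1` has at most `1/2 + o(1)` correlation with it when the
inputs are drawn from the distribution `𝒟_n`. So it follows from the standard connection
between `PH` and `AC⁰` that `PH^O` is infinite with probability `1` when `O ∼ 𝒟_O`."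

**This file proves that standard connection over `𝒟_O`**, following the tree's derivation of
RST Thm. 2 from Thm. 1 for the uniform random oracle (`RandomOraclePHProofs.lean`: Furst–Saxe–
Sipser / Ko 1989 §4.2 / Bennett–Gill 1981 §1), with the product structure of `𝒟_O` supplied by
the coin space of `acOracleMeasure = acCoinMeasure.map acOracleOf` (`AaronsonChenOracle.lean`)
and the level decomposition `acReadout` / `acRest` of `AaronsonChenPHWindow.lean`:

1. `AcPH.correctAt k A Dsc m` — the event "the description `Dsc` (`PHDescr`, `k` quantifier
   bounds) decides `Sipser_{k+3} ∘ OR` of `A ⊕ O` correctly at the RST input `sipserInput m (k+3)`";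
   it reads `O` only below `AcPH.reachAt` (`AcPH.correctAt_congr`), hence is measurable;
2. at that input the language is `Sipser_{k+3}` of the block coins of the level
   (`AcPH.inp_mem_sipserOrLang_acOracleOf`: the hidden bit `g(p)` of an assigned block is its
   block coin), and the predicate is an `acBasis` circuit of `acDepth ≤ k + 2` and size
   `2^{poly(|x|)}` in the window bits `[p_a · e ∈ O]` of the level, for EVERY rest of the oracle
   (the tree's PROVED `fSS84_phWindowCircuits_holds`, moved to the window `Addr ws × Fin 2^ℓ`
   through the join `A ⊕ ·`: `AcPH.exists_windowCircuit`); so, conditionally on the rest, the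
   event is a relation `AcPH.levelRel` between the (uniform, independent) level readout and the
   rest, and Lemma 5.5 fed with RST Thm. 1 (`rst_thm1_regime_of_inRegime` at `θ = 3/5`) bounds
   the number of readouts satisfying it by `3/5` of all readouts (`AcPH.levelBound`);
3. conditioning on the independent rest (`measure_rel_inter_le`, `AaronsonChenPHMeasure.lean`)
   multiplies these bounds along sparse parameters, each beyond the reach of all earlier events
   (`AcPH.sparse`, `AcPH.measure_forall_lt_le_pow`): a fixed description is correct at all of
   them with `acCoinMeasure`-probability `0`, hence describes `Sipser_{k+3} ∘ OR` with
   `𝒟_O`-probability `0` (`AcPH.acOracleMeasure_lang_eq_zero`);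
4. over the countably many descriptions of `Σₖ^{A ⊕ O}` languages
   (`exists_levelLang_of_mem_sigmaPRel`, `exists_enum_PHDescr countable_polyTimeOracleAlg_holds`):
   `ae_sipserOrLang_not_mem_sigmaPRel`, i.e. **`sipserOrLang_ae_not_mem_sigmaPRel_holds`**.

Consequences recorded here: **`aaronsonChen2017_thm51_ph_holds`** — the named fact
`aaronsonChen2017_thm51_ph` of `AaronsonChenOracle.lean` ("`PH^{TQBF ⊕ O}` is infinite for
`𝒟_O`-almost every `O`", Thm. 5.1 second half) is now a theorem of the tree
(`aaronsonChen2017_thm51_ph_of_parts` with `sipserOrLang_mem_PHRel_holds`,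
`AaronsonChenPHUpper.lean`), and `ae_isInfinitePHRel_oracleJoin_holds` (every left oracle `A`).

## References

* [AaronsonChen2017] arXiv:1612.05903, `lit read` pp. 20–21 (§5.2: `𝒟_n`, `𝒟_O`, independent
  levels), p. 24 (§5.4: Thm. 5.4, Lemma 5.5, proof of the second part of Thm. 5.1).
* [RossmanServedioTan2015] arXiv:1504.03398, Thm. 1 (p. 3), §2.3 (p. 7: Thm. 2 from Thm. 1).
* [Ko1989] K.-I Ko, *Constructing oracles by lower bound techniques for circuits*, §2, §4.2.
* [BennettGill1981] C. H. Bennett, J. Gill, SIAM J. Comput. 10 (1981), §1 (measure-one arguments).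
-/

noncomputable section

namespace Literature.Barriers.QuantumAdvantage

open MeasureTheory ProbabilityTheory _root_.Computability Literature.Computability.Complexity
  Literature.Computability.QuantumComplexity Finset
open scoped ENNReal

/-! ### Locality of patches, joins and `Sipser ∘ OR` -/

/-- Patching the same window of two backgrounds that agree on a string gives languages that agree
on that string. [folklore] -/
theorem patchLang_congr_of_agree {ι : Type*} {y y' : Language Bool} (e : ι → List Bool)
    (w : ι → Bool) {s : List Bool} (h : s ∈ y ↔ s ∈ y') :
    s ∈ patchLang y e w ↔ s ∈ patchLang y' e w := by
  show ((∃ k, e k = s ∧ w k = true) ∨ ((∀ k, e k ≠ s) ∧ s ∈ y)) ↔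
    ((∃ k, e k = s ∧ w k = true) ∨ ((∀ k, e k ≠ s) ∧ s ∈ y'))
  rw [h]

/-- Joins `A ⊕ O`, `A ⊕ O'` agree on the strings of length `≤ R` as soon as `O`, `O'` agree on the
strings `t` with `|t| + 1 ≤ R` (the query `1t` reads `t`). [cite: AaronsonChen2017, §5 (p. 20, O₀ ⊕ O₁)] -/
theorem oracleJoin_congr_of_agree {A O O' : Language Bool} {R : ℕ}
    (h : ∀ t : List Bool, t.length + 1 ≤ R → (t ∈ O ↔ t ∈ O')) :
    ∀ s : List Bool, s.length ≤ R → (s ∈ oracleJoin A O ↔ s ∈ oracleJoin A O')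
  | [], _ => by simp
  | false :: t, _ => by simp
  | true :: t, hs => by
    rw [true_cons_mem_oracleJoin, true_cons_mem_oracleJoin]
    exact h t (by simpa using hs)

/-- **Locality of `Sipser_d ∘ OR`**: membership of `x` reads only the strings of length `2|x| + 1`
of the oracle (the hidden bits of level `|x|` query `1 · p · e`, `|p| = |e| = |x|`).
[cite: AaronsonChen2017, §5.2 (p. 20) and Lemma 5.5 (p. 24)] -/
theorem sipserOrLang_congr {d : ℕ} {B B' : Language Bool} {x : List Bool}
    (h : ∀ s : List Bool, s.length = 2 * x.length + 1 → (s ∈ B ↔ s ∈ B')) :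
    x ∈ sipserOrLang d B ↔ x ∈ sipserOrLang d B' := by
  have hb : ∀ i : ℕ, blockOr B x.length i ↔ blockOr B' x.length i := by
    intro i
    simp only [blockOr]
    refine exists_congr fun e => and_congr_right fun he => h _ ?_
    simp [he]
    omega
  have hfun : ∀ ws : List ℕ,
      (fun a : Addr ws => @decide (blockOr B x.length (addrIndex ws a)) (Classical.dec _)) =
        fun a => @decide (blockOr B' x.length (addrIndex ws a)) (Classical.dec _) := by
    intro ws
    funext a
    rw [Bool.eq_iff_iff, @decide_eq_true_iff _ (Classical.dec _), @decide_eq_true_iff _ (Classical.dec _)]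
    exact hb _
  simp only [sipserOrLang]
  refine exists_congr fun ws => ?_
  rw [hfun ws]

/-- `Sipser ∘ OR` of the window of a readout is `Sipser` of its block bits (`sipserOr_blockWin`
for a readout given as one function). [cite: AaronsonChen2017, proof of Lemma 5.5 (p. 24)] -/
theorem sipserOr_blockWin' {ws : List ℕ} {π : Type*} [Fintype π] [DecidableEq π] (root : Bool)
    (c : Addr ws → π × Bool) :
    sipserOr ws root (blockWin c) = sipserEval ws root (fun a => (c a).2) :=
  sipserOr_blockWin root (fun a => (c a).1) (fun a => (c a).2)

namespace AcPH

/-! ### The levels of the diagonalization -/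

/-- The depth of the `Sipser ∘ OR` language used against level `k`: `d = k + 3` (a `Σₖ`
predicate is a depth-`(k+2)` window circuit, and Lemma 5.5 defeats depth `d - 1`).
[cite: AaronsonChen2017, §5.4 (p. 24)] -/
abbrev dp (k : ℕ) : ℕ := k + 3

/-- The RST input of parameter `m` used against level `k`. [cite: RossmanServedioTan2015, §6 (p. 15)] -/
abbrev inp (k m : ℕ) : List Bool := sipserInput m (dp k)

/-- The oracle level `ℓ = |x|` of that input (its blocks are the `B_{ℓ,p}`). [cite: AaronsonChen2017, §5.2 (p. 20)] -/
abbrev lvl (k m : ℕ) : ℕ := (inp k m).length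

/-- The fan-ins of `Sipser_{k+3}` at parameter `m`. [cite: RossmanServedioTan2015, §6 (p. 15)] -/
abbrev fanins (k m : ℕ) : List ℕ := rstFanins m (dp k)

/-- `d = k + 3 ≥ 2`. [folklore] -/
theorem two_le_dp (k : ℕ) : 2 ≤ dp k := by
  simp [dp]

/-- The `n` leaves fit into the `2^ℓ` blocks of the level. [folklore] -/
theorem fit (k m : ℕ) : (fanins k m).prod ≤ 2 ^ lvl k m :=
  (rstN_lt_two_pow_length_sipserInput m (dp k)).le

/-- The level is at least the parameter: `m ≤ ℓ`. [folklore] -/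
theorem le_lvl (k m : ℕ) : m ≤ lvl k m :=
  le_length_sipserInput m (dp k)

/-- The event "the description `Dsc` decides `Sipser_{k+3} ∘ OR` of `A ⊕ O` correctly at the RST
input of parameter `m`", as a set of right oracles `O`. [cite: BennettGill1981, §1] [cite: AaronsonChen2017, §5.4 (p. 24)] -/
def correctAt (k : ℕ) (A : Language Bool) (Dsc : PHDescr) (m : ℕ) : Set (Set (List Bool)) :=
  {O | inp k m ∈ Dsc.lang (oracleJoin A O) ↔ inp k m ∈ sipserOrLang (dp k) (oracleJoin A O)}

/-- The length up to which `correctAt k A Dsc m` reads the right oracle: the reach of the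
description and the length `2ℓ` of the block strings. [cite: BennettGill1981, §1] -/
def reachAt (k : ℕ) (Dsc : PHDescr) (m : ℕ) : ℕ :=
  max (Dsc.reach (lvl k m)) (2 * lvl k m)

/-- **Locality of the events**: right oracles agreeing below the reach agree on `correctAt`.
[cite: BennettGill1981, §1] -/
theorem correctAt_congr {k : ℕ} {A : Language Bool} {Dsc : PHDescr} {m : ℕ} {O O' : Set (List Bool)}
    (h : ∀ s : List Bool, s.length ≤ reachAt k Dsc m → (s ∈ O ↔ s ∈ O')) :
    O ∈ correctAt k A Dsc m ↔ O' ∈ correctAt k A Dsc m := by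
  have h1 : Dsc.reach (inp k m).length ≤ reachAt k Dsc m := le_max_left _ _
  have h2 : 2 * (inp k m).length ≤ reachAt k Dsc m := le_max_right _ _
  simp only [correctAt, Set.mem_setOf_eq]
  refine iff_congr ?_ ?_
  · exact Dsc.lang_congr (inp k m) (oracleJoin_congr_of_agree fun t ht => h t (by omega))
  · exact sipserOrLang_congr fun s hs =>
      oracleJoin_congr_of_agree (A := A) (R := 2 * (inp k m).length + 1) (fun t ht => h t (by omega)) s hs.le

/-- The events are measurable. [folklore] -/
theorem measurableSet_correctAt (k : ℕ) (A : Language Bool) (Dsc : PHDescr) (m : ℕ) :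
    MeasurableSet (correctAt k A Dsc m) :=
  measurableSet_of_determined (reachAt k Dsc m) fun _ _ h => correctAt_congr h

/-! ### The language at the RST input: `Sipser` of the block coins -/

/-- At the RST input the language is the formula `Sipser_{k+3}` on the hidden bits of the assigned
blocks of the level. [cite: AaronsonChen2017, Lemma 5.5 (p. 24)] -/
theorem inp_mem_sipserOrLang_iff (k m : ℕ) (B : Language Bool) :
    inp k m ∈ sipserOrLang (dp k) B ↔
      sipserEval (fanins k m) (Nat.bodd (dp k))
        (fun a => @decide (blockOr B (lvl k m) (addrIndex (fanins k m) a)) (Classical.dec _)) = true := by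
  show sipserInput m (dp k) ∈ sipserOrLang (dp k) B ↔ _
  rw [sipserInput, boolPair_mem_sipserOrLang_iff (length_rstFanins (two_le_dp k) m), ← sipserInput]
  exact ⟨fun h => h.2, fun h => ⟨fit k m, h⟩⟩

/-- **The hidden bit of an assigned block of `A ⊕ O(ω)` is its block coin.**
[cite: AaronsonChen2017, §5.2 (p. 20, "g(p) := ⋁_{x ∈ B_{n,p}} f_n(x)")] -/
theorem blockOr_acOracleOf_iff (A : Language Bool) (ℓ : ℕ) (ws : List ℕ) (ω : Set AcCoin)
    (a : Addr ws) :
    blockOr (oracleJoin A (acOracleOf ω)) ℓ (addrIndex ws a) ↔ Sum.inl (acPfx ℓ ws a) ∈ ω := by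
  rw [blockOr_oracleJoin_iff]
  have h := Set.ext_iff.1 (acOracleOf_preimage_block (acPfx ℓ ws a)) ω
  simp only [Set.mem_preimage, Set.mem_setOf_eq, length_acPfx] at h
  exact h

/-- The block bit of the readout is the block coin. [cite: AaronsonChen2017, §5.2 (p. 20)] -/
theorem snd_acReadout (ℓ : ℕ) (ws : List ℕ) (ω : Set AcCoin) (a : Addr ws) :
    (acReadout ℓ ws ω a).2 = ω.boolIndicator (Sum.inl (acPfx ℓ ws a)) := rfl

/-- **The language side of the event**: at the RST input, `Sipser_{k+3} ∘ OR` of `A ⊕ O(ω)` is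
`Sipser_{k+3}` of the block bits of the level readout of `ω`. [cite: AaronsonChen2017, Lemma 5.5 and §5.4 (p. 24)] -/
theorem inp_mem_sipserOrLang_acOracleOf (k m : ℕ) (A : Language Bool) (ω : Set AcCoin) :
    inp k m ∈ sipserOrLang (dp k) (oracleJoin A (acOracleOf ω)) ↔
      sipserEval (fanins k m) (Nat.bodd (dp k))
        (fun a => (acReadout (lvl k m) (fanins k m) ω a).2) = true := by
  rw [inp_mem_sipserOrLang_iff]
  have hfun : (fun a => @decide (blockOr (oracleJoin A (acOracleOf ω)) (lvl k m)
      (addrIndex (fanins k m) a)) (Classical.dec _)) =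
        fun a => (acReadout (lvl k m) (fanins k m) ω a).2 := by
    funext a
    rw [snd_acReadout, Bool.eq_iff_iff, @decide_eq_true_iff _ (Classical.dec _), blockOr_acOracleOf_iff]
    exact Set.mem_iff_boolIndicator _ _
  rw [hfun]

/-! ### The relation between readout and rest -/

/-- **The event, conditionally on the rest**: for a readout value `c` and a rest `y`, "the
description is correct at the RST input about the oracle `A ⊕ (y patched by the window of c)`" —
the predicate side reads the patched oracle, the language side is `Sipser_{k+3}` of the block
bits of `c`. [cite: AaronsonChen2017, §5.4 (p. 24)] [cite: BennettGill1981, §1] -/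
def levelRel (k : ℕ) (A : Language Bool) (Dsc : PHDescr) (m : ℕ)
    (c : Addr (fanins k m) → Fin (2 ^ lvl k m) × Bool) (y : Set (List Bool)) : Prop :=
  (inp k m ∈ Dsc.lang (oracleJoin A (patchLang y (acWinStr (lvl k m) (fanins k m)) (blockWin c)))) ↔
    sipserEval (fanins k m) (Nat.bodd (dp k)) (fun a => (c a).2) = true

/-- **The event is the relation between the level readout and the rest of `ω`** (the oracle is
its rest patched by the window of its readout, `patchLang_acRest`). [cite: AaronsonChen2017, §5.2 (pp. 20–21)] -/
theorem mem_correctAt_iff_levelRel (k : ℕ) (A : Language Bool) (Dsc : PHDescr) (m : ℕ)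
    (ω : Set AcCoin) :
    acOracleOf ω ∈ correctAt k A Dsc m ↔
      levelRel k A Dsc m (acReadout (lvl k m) (fanins k m) ω) (acRest (lvl k m) (fanins k m) ω) := by
  simp only [correctAt, Set.mem_setOf_eq, levelRel]
  rw [inp_mem_sipserOrLang_acOracleOf, patchLang_acRest (lvl k m) (fanins k m) (fit k m) ω]

/-- The relation reads the rest only below the reach of the description. [cite: BennettGill1981, §1] -/
theorem levelRel_congr {k : ℕ} {A : Language Bool} {Dsc : PHDescr} {m : ℕ}
    {c : Addr (fanins k m) → Fin (2 ^ lvl k m) × Bool} {y y' : Set (List Bool)}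
    (h : ∀ s : List Bool, s.length ≤ Dsc.reach (lvl k m) → (s ∈ y ↔ s ∈ y')) :
    levelRel k A Dsc m c y ↔ levelRel k A Dsc m c y' := by
  simp only [levelRel]
  refine iff_congr (Dsc.lang_congr _ (oracleJoin_congr_of_agree fun t ht => ?_)) Iff.rfl
  have ht' : t.length + 1 ≤ Dsc.reach (lvl k m) := ht
  exact patchLang_congr_of_agree _ _ (h t (by omega))

/-- The slices `{y | levelRel … c y}` are measurable. [folklore] -/
theorem measurableSet_levelRel (k : ℕ) (A : Language Bool) (Dsc : PHDescr) (m : ℕ)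
    (c : Addr (fanins k m) → Fin (2 ^ lvl k m) × Bool) :
    MeasurableSet {y : Set (List Bool) | levelRel k A Dsc m c y} :=
  measurableSet_of_determined (Dsc.reach (lvl k m)) fun _ _ h => levelRel_congr h

/-! ### Conditioning on the rest of the oracle -/

/-- **The conditioning step over `𝒟_O`** (Bennett–Gill's Lemma 1 in use, on the coin space): if
for every rest `y` at most a `θ`-fraction of the readout values `c` satisfy `R c y`, then for
every measurable set `G` of rests, `acCoinMeasure (R(readout, rest) ∧ rest ∈ G) ≤ θ · acCoinMeasure (rest ∈ G)`
— the readout is uniform and independent of the rest (`AaronsonChenPHWindow.lean`).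
[cite: BennettGill1981, §1 (Lemma 1)] [cite: AaronsonChen2017, §5.2 (p. 20, independent levels)] -/
theorem acCoinMeasure_inter_le {ℓ : ℕ} {ws : List ℕ} (hfit : ws.prod ≤ 2 ^ ℓ)
    {R : (Addr ws → Fin (2 ^ ℓ) × Bool) → Set (List Bool) → Prop}
    (hR : ∀ c, MeasurableSet {y | R c y}) {G : Set (Set (List Bool))} (hG : MeasurableSet G)
    {θ : ℝ}
    (hθ : ∀ y : Set (List Bool), ∃ S : Finset (Addr ws → Fin (2 ^ ℓ) × Bool),
      (∀ c, c ∈ S ↔ R c y) ∧ (S.card : ℝ) ≤ θ * Fintype.card (Addr ws → Fin (2 ^ ℓ) × Bool)) :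
    acCoinMeasure ({ω | R (acReadout ℓ ws ω) (acRest ℓ ws ω)} ∩ acRest ℓ ws ⁻¹' G) ≤
      ENNReal.ofReal θ * acCoinMeasure (acRest ℓ ws ⁻¹' G) := by
  refine measure_rel_inter_le (measurable_acReadout' ℓ ws hfit) (measurable_acRest' ℓ ws)
    (indepFun_acReadout_acRest ℓ ws hfit) hR hG fun y _ => ?_
  obtain ⟨S, hS, hcard⟩ := hθ y
  have hset : {ω : Set AcCoin | R (acReadout ℓ ws ω) y} = {ω | acReadout ℓ ws ω ∈ S} := by
    ext ω
    simp only [Set.mem_setOf_eq, hS]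
  rw [hset]
  exact acCoinMeasure_acReadout_mem_le ℓ ws hfit S hcard

/-! ### The per-level bound: the window circuit of the predicate against Lemma 5.5 -/

/-- **RST Thm. 1 as a correlation bound for `Sipser_{k+3}`** (`CorrBound`, the hypothesis of
`lemma55_finite`), at `θ = 3/5` and polylogarithmic size exponents, for all large `m` — from the
tree's proof `rossmanServedioTan2015_thm1_inRegime_holds` through `rst_thm1_regime_of_inRegime`.
[cite: RossmanServedioTan2015, Thm. 1 (p. 3)] [cite: AaronsonChen2017, Thm. 5.4 (p. 24)] -/
theorem corrBound_rst (k c₂ kk : ℕ) : ∃ m₁ : ℕ, ∀ m : ℕ, m₁ ≤ m →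
    (1 ≤ m ∧ 1 ≤ rstW m ∧ 1 ≤ rstW0 m (dp k) ∧ m ≤ Nat.log 2 (rstN m (dp k)) + 2) ∧
    CorrBound (fanins k m) (Nat.bodd (dp k)) (dp k - 1)
      (2 ^ (c₂ * (6 * Nat.log 2 (rstN m (dp k)) + (12 * dp k + 9)) ^ kk + c₂)) (3 / 5) := by
  obtain ⟨m₁, hm₁⟩ := rst_thm1_regime_of_inRegime rossmanServedioTan2015_thm1_inRegime_holds
    rossmanServedioTan2015_w0_asymp_holds (two_le_dp k) c₂ kk 6 (12 * dp k + 9)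
  refine ⟨m₁, fun m hm => ⟨(hm₁ m hm).1, fun F hF hd hs => ?_⟩⟩
  exact (hm₁ m hm).2 F hF hd hs

/-- **The window circuit of a `PH` predicate through the join** (Furst–Saxe–Sipser / Ko, Lemma 2.3,
the tree's `FSS84_phWindowCircuits`, over the window `Addr ws × Fin 2^ℓ` of a level): for every
input `x`, left oracle `A` and rest `y` there is an `acBasis` circuit of `acDepth ≤ |bounds| + 2`
and size `≤ 2^{S(|x|)}` whose value on a window `w` is `[x ∈ Dsc.lang (A ⊕ (y patched by w))]`.
[cite: Ko1989, Lemma 2.3] [cite: AaronsonChen2017, §5.4 (p. 24, "the standard connection between PH and AC⁰")] -/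
theorem exists_windowCircuit (Dsc : PHDescr) {Sz : Polynomial ℕ}
    (hS : ∀ (x : List Bool) (W : ℕ) (e : Fin W → List Bool), Function.Injective e →
      ∀ A₀ : Language Bool, ∃ C : Circuit (Fin W), C.IsOver acBasis ∧
        C.acDepth ≤ Dsc.bounds.length + 2 ∧ C.size ≤ 2 ^ Sz.eval x.length ∧
        ∀ w : Fin W → Bool, C.eval w = (Dsc.lang (patchLang A₀ e w)).boolIndicator x)
    (x : List Bool) {ℓ : ℕ} {ws : List ℕ} (hfit : ws.prod ≤ 2 ^ ℓ) (A y : Language Bool) :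
    ∃ C : Circuit (Addr ws × Fin (2 ^ ℓ)), C.IsOver acBasis ∧ C.acDepth ≤ Dsc.bounds.length + 2 ∧
      C.size ≤ 2 ^ Sz.eval x.length ∧
      ∀ w : Addr ws × Fin (2 ^ ℓ) → Bool,
        (C.eval w = true ↔ x ∈ Dsc.lang (oracleJoin A (patchLang y (acWinStr ℓ ws) w))) := by
  classical
  let τ : Addr ws × Fin (2 ^ ℓ) ≃ Fin (Fintype.card (Addr ws × Fin (2 ^ ℓ))) := Fintype.equivFin _
  have heinj : Function.Injective (fun i : Fin (Fintype.card (Addr ws × Fin (2 ^ ℓ))) =>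
      true :: acWinStr ℓ ws (τ.symm i)) := fun i j hij =>
    τ.symm.injective (acWinStr_injective ℓ ws hfit (List.cons_eq_cons.1 hij).2)
  obtain ⟨C, hB, hd, hs, hev⟩ := hS x _ _ heinj (oracleJoin A y)
  refine ⟨C.mapInputs τ.symm, hB.mapInputs _, by simpa using hd, by simpa using hs, fun w => ?_⟩
  have hpatch : patchLang (oracleJoin A y) (fun i => true :: acWinStr ℓ ws (τ.symm i))
      (fun i => w (τ.symm i)) = oracleJoin A (patchLang y (acWinStr ℓ ws) w) := by
    rw [patchLang_oracleJoin A y (fun i => acWinStr ℓ ws (τ.symm i)) (fun i => w (τ.symm i))]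
    exact congrArg (oracleJoin A)
      (_root_.Literature.Barriers.QuantumAdvantage.patchLang_comp_equiv y (acWinStr ℓ ws) w τ.symm)
  rw [Circuit.eval_mapInputs, hev, hpatch]
  exact (Set.mem_iff_boolIndicator _ _).symm

/-- **The per-level bound** (Lemma 5.5 against the window circuit): for a description with `k`
quantifier bounds, for all large `m` and EVERY rest `y`, at most a `3/5`-fraction of the
`(2 · 2^ℓ)ⁿ` level readouts satisfy the level relation (the predicate at the RST input is a
depth-`(k+2)`, size-`2^{polylog n}` circuit in the window, `Sipser_{k+3} ∘ OR` of the window is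
`Sipser_{k+3}` of the block bits, and `lemma55_finite` with RST Thm. 1 bounds the agreements).
[cite: AaronsonChen2017, Lemma 5.5 and §5.4 (p. 24)] [cite: RossmanServedioTan2015, Thm. 1 (p. 3)] -/
theorem levelBound (k : ℕ) (A : Language Bool) (Dsc : PHDescr) (hk : Dsc.bounds.length = k) :
    ∃ m₁ : ℕ, ∀ m : ℕ, m₁ ≤ m → ∀ y : Set (List Bool),
      ∃ S : Finset (Addr (fanins k m) → Fin (2 ^ lvl k m) × Bool),
        (∀ c, c ∈ S ↔ levelRel k A Dsc m c y) ∧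
        (S.card : ℝ) ≤ 3 / 5 * Fintype.card (Addr (fanins k m) → Fin (2 ^ lvl k m) × Bool) := by
  classical
  obtain ⟨Sz, hSz⟩ := fSS84_phWindowCircuits_holds Dsc
  obtain ⟨c₂, kk, hck⟩ := exists_eval_le_mul_pow_add Sz
  obtain ⟨m₁, hm₁⟩ := corrBound_rst k c₂ kk
  refine ⟨m₁, fun m hm y => ?_⟩
  obtain ⟨⟨hm1, hW, hW0, hlog⟩, hcorr⟩ := hm₁ m hm
  obtain ⟨C, hB, hd, hs, hev⟩ := exists_windowCircuit Dsc hSz (inp k m) (fit k m) A y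
  have hlen : lvl k m ≤ 6 * Nat.log 2 (rstN m (dp k)) + (12 * dp k + 9) :=
    length_sipserInput_le (two_le_dp k) hm1 hW hW0 hlog
  have hs' : C.size ≤ 2 ^ (c₂ * (6 * Nat.log 2 (rstN m (dp k)) + (12 * dp k + 9)) ^ kk + c₂) := by
    refine hs.trans (Nat.pow_le_pow_right (by norm_num) ?_)
    exact (TM2Iter.eval_mono Sz hlen).trans (hck _)
  have hd' : C.acDepth ≤ dp k - 1 := by
    rw [hk] at hd
    exact hd.trans (by simp [dp])
  refine ⟨univ.filter fun c => C.eval (blockWin c) = sipserOr (fanins k m) (Nat.bodd (dp k)) (blockWin c),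
    fun c => ?_, ?_⟩
  · simp only [mem_filter, mem_univ, true_and]
    rw [levelRel, ← hev (blockWin c), sipserOr_blockWin']
    exact Bool.eq_iff_iff
  · have h := lemma55_finite_div hcorr (by simp [dp]) Nat.one_le_two_pow C hB hd' hs'
    have hpos : (0 : ℝ) < Fintype.card (Addr (fanins k m) → Fin (2 ^ lvl k m) × Bool) := by
      exact_mod_cast Fintype.card_pos
    rwa [div_le_iff₀ hpos] at h

/-! ### Sparse parameters and probability zero for one description -/

/-- The sparse sequence of parameters: start at `m₁`, and let each parameter exceed the previous
one and the reach of the event at the previous one. [cite: BennettGill1981, §1] -/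
def sparse (k : ℕ) (Dsc : PHDescr) (m₁ : ℕ) : ℕ → ℕ
  | 0 => m₁
  | j + 1 => max (sparse k Dsc m₁ j + 1) (reachAt k Dsc (sparse k Dsc m₁ j) + 1)

/-- The sparse parameters start above `m₁`. [folklore] -/
theorem le_sparse (k : ℕ) (Dsc : PHDescr) (m₁ : ℕ) : ∀ j, m₁ ≤ sparse k Dsc m₁ j
  | 0 => le_rfl
  | j + 1 => (le_sparse k Dsc m₁ j).trans ((Nat.le_succ _).trans (le_max_left _ _))

/-- The sparse parameters are strictly increasing. [folklore] -/
theorem sparse_strictMono (k : ℕ) (Dsc : PHDescr) (m₁ : ℕ) : StrictMono (sparse k Dsc m₁) :=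
  strictMono_nat_of_lt_succ fun j => Nat.lt_of_succ_le (le_max_left (sparse k Dsc m₁ j + 1) _)

/-- Each sparse parameter exceeds the reaches at all earlier ones. [folklore] -/
theorem reachAt_lt_sparse (k : ℕ) (Dsc : PHDescr) (m₁ : ℕ) {i j : ℕ} (hij : i < j) :
    reachAt k Dsc (sparse k Dsc m₁ i) < sparse k Dsc m₁ j := by
  have h1 : reachAt k Dsc (sparse k Dsc m₁ i) < sparse k Dsc m₁ (i + 1) :=
    Nat.lt_of_succ_le (le_max_right _ _)
  exact h1.trans_le ((sparse_strictMono k Dsc m₁).monotone hij)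

/-- **Earlier events do not see the window of a later level**: for `i < j`, the event at the
`i`-th sparse parameter holds for `O(ω)` iff it holds for the rest of `O(ω)` off the level of the
`j`-th one (the two agree on all strings of length `≠ 2ℓ_j > reach_i`). [cite: BennettGill1981, §1] -/
theorem mem_correctAt_sparse_iff_acRest (k : ℕ) (A : Language Bool) (Dsc : PHDescr) (m₁ : ℕ)
    {i j : ℕ} (hij : i < j) (ω : Set AcCoin) :
    acOracleOf ω ∈ correctAt k A Dsc (sparse k Dsc m₁ i) ↔
      acRest (lvl k (sparse k Dsc m₁ j)) (fanins k (sparse k Dsc m₁ j)) ω ∈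
        correctAt k A Dsc (sparse k Dsc m₁ i) := by
  refine correctAt_congr fun s hs => (mem_acRest_iff_of_length_ne _ _ ?_).symm
  have h1 := reachAt_lt_sparse k Dsc m₁ hij
  have h2 := le_lvl k (sparse k Dsc m₁ j)
  omega

/-- **The product bound**: a fixed description with `k` quantifier bounds is correct at the first
`J` sparse parameters with `acCoinMeasure`-probability at most `(3/5)^J`.
[cite: BennettGill1981, §1] [cite: AaronsonChen2017, §5.4 (p. 24)] -/
theorem measure_forall_lt_le_pow (k : ℕ) (A : Language Bool) (Dsc : PHDescr)
    (hk : Dsc.bounds.length = k) :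
    ∃ m₁ : ℕ, ∀ J : ℕ,
      acCoinMeasure {ω | ∀ j, j < J → acOracleOf ω ∈ correctAt k A Dsc (sparse k Dsc m₁ j)} ≤
        ENNReal.ofReal (3 / 5) ^ J := by
  obtain ⟨m₁, hm₁⟩ := levelBound k A Dsc hk
  refine ⟨m₁, fun J => ?_⟩
  induction J with
  | zero => simp
  | succ J ih =>
    -- the level of the new parameter
    have hG : MeasurableSet {y : Set (List Bool) | ∀ j, j < J → y ∈ correctAt k A Dsc (sparse k Dsc m₁ j)} := by
      have : {y : Set (List Bool) | ∀ j, j < J → y ∈ correctAt k A Dsc (sparse k Dsc m₁ j)} =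
          ⋂ j, ⋂ (_ : j < J), correctAt k A Dsc (sparse k Dsc m₁ j) := by
        ext y
        simp
      rw [this]
      exact MeasurableSet.iInter fun j => MeasurableSet.iInter fun _ => measurableSet_correctAt _ _ _ _
    have hrest : ∀ ω : Set AcCoin,
        (∀ j, j < J → acOracleOf ω ∈ correctAt k A Dsc (sparse k Dsc m₁ j)) ↔
          ∀ j, j < J → acRest (lvl k (sparse k Dsc m₁ J)) (fanins k (sparse k Dsc m₁ J)) ω ∈
            correctAt k A Dsc (sparse k Dsc m₁ j) := fun ω =>
      forall₂_congr fun j hj => mem_correctAt_sparse_iff_acRest k A Dsc m₁ hj ω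
    have hset : {ω : Set AcCoin | ∀ j, j < J + 1 → acOracleOf ω ∈ correctAt k A Dsc (sparse k Dsc m₁ j)} =
        {ω | levelRel k A Dsc (sparse k Dsc m₁ J)
            (acReadout (lvl k (sparse k Dsc m₁ J)) (fanins k (sparse k Dsc m₁ J)) ω)
            (acRest (lvl k (sparse k Dsc m₁ J)) (fanins k (sparse k Dsc m₁ J)) ω)} ∩
          acRest (lvl k (sparse k Dsc m₁ J)) (fanins k (sparse k Dsc m₁ J)) ⁻¹'
            {y | ∀ j, j < J → y ∈ correctAt k A Dsc (sparse k Dsc m₁ j)} := by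
      ext ω
      simp only [Set.mem_setOf_eq, Set.mem_inter_iff, Set.mem_preimage]
      constructor
      · intro h
        exact ⟨(mem_correctAt_iff_levelRel k A Dsc _ ω).1 (h J (Nat.lt_succ_self J)),
          (hrest ω).1 fun j hj => h j (Nat.lt_succ_of_lt hj)⟩
      · rintro ⟨hJ, hlt⟩ j hj
        rcases Nat.lt_succ_iff_lt_or_eq.1 hj with hj' | rfl
        · exact ((hrest ω).2 hlt) j hj'
        · exact (mem_correctAt_iff_levelRel k A Dsc _ ω).2 hJ
    have hpre : acRest (lvl k (sparse k Dsc m₁ J)) (fanins k (sparse k Dsc m₁ J)) ⁻¹'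
        {y | ∀ j, j < J → y ∈ correctAt k A Dsc (sparse k Dsc m₁ j)} =
        {ω | ∀ j, j < J → acOracleOf ω ∈ correctAt k A Dsc (sparse k Dsc m₁ j)} := by
      ext ω
      exact (hrest ω).symm
    rw [hset]
    calc acCoinMeasure ({ω | levelRel k A Dsc (sparse k Dsc m₁ J)
            (acReadout (lvl k (sparse k Dsc m₁ J)) (fanins k (sparse k Dsc m₁ J)) ω)
            (acRest (lvl k (sparse k Dsc m₁ J)) (fanins k (sparse k Dsc m₁ J)) ω)} ∩
          acRest (lvl k (sparse k Dsc m₁ J)) (fanins k (sparse k Dsc m₁ J)) ⁻¹'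
            {y | ∀ j, j < J → y ∈ correctAt k A Dsc (sparse k Dsc m₁ j)})
        ≤ ENNReal.ofReal (3 / 5) * acCoinMeasure
            (acRest (lvl k (sparse k Dsc m₁ J)) (fanins k (sparse k Dsc m₁ J)) ⁻¹'
              {y | ∀ j, j < J → y ∈ correctAt k A Dsc (sparse k Dsc m₁ j)}) :=
          acCoinMeasure_inter_le (fit k _) (fun c => measurableSet_levelRel k A Dsc _ c) hG
            (hm₁ _ (le_sparse k Dsc m₁ J))
      _ ≤ ENNReal.ofReal (3 / 5) * ENNReal.ofReal (3 / 5) ^ J := by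
          rw [hpre]
          exact mul_le_mul' le_rfl ih
      _ = ENNReal.ofReal (3 / 5) ^ (J + 1) := by rw [pow_succ']

/-- **A fixed description is correct at all sparse parameters with probability `0`.**
[cite: BennettGill1981, §1] [cite: AaronsonChen2017, §5.4 (p. 24)] -/
theorem measure_forall_correctAt_eq_zero (k : ℕ) (A : Language Bool) (Dsc : PHDescr)
    (hk : Dsc.bounds.length = k) :
    ∃ m₁ : ℕ, acCoinMeasure {ω | ∀ j, acOracleOf ω ∈ correctAt k A Dsc (sparse k Dsc m₁ j)} = 0 := by
  obtain ⟨m₁, h⟩ := measure_forall_lt_le_pow k A Dsc hk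
  refine ⟨m₁, le_antisymm ?_ bot_le⟩
  have hsub : ∀ J : ℕ, {ω : Set AcCoin | ∀ j, acOracleOf ω ∈ correctAt k A Dsc (sparse k Dsc m₁ j)} ⊆
      {ω | ∀ j, j < J → acOracleOf ω ∈ correctAt k A Dsc (sparse k Dsc m₁ j)} :=
    fun J ω hω j _ => hω j
  have hle : ∀ J : ℕ, acCoinMeasure {ω | ∀ j, acOracleOf ω ∈ correctAt k A Dsc (sparse k Dsc m₁ j)} ≤
      ENNReal.ofReal (3 / 5) ^ J := fun J =>
    (measure_mono (hsub J)).trans (h J)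
  exact ge_of_tendsto' (ENNReal.tendsto_pow_atTop_nhds_zero_of_lt_one
    (ENNReal.ofReal_lt_one.2 (by norm_num))) hle

/-- **A fixed description describes `Sipser_{k+3} ∘ OR` of `A ⊕ O` with `𝒟_O`-probability `0`**
(push-forward to `acOracleMeasure = acCoinMeasure.map acOracleOf` of the measurable superset
"correct at all sparse parameters"). [cite: AaronsonChen2017, §5.4 (p. 24)] [cite: BennettGill1981, §1] -/
theorem acOracleMeasure_lang_eq_zero (k : ℕ) (A : Language Bool) (Dsc : PHDescr)
    (hk : Dsc.bounds.length = k) :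
    acOracleMeasure {O | ∀ x : List Bool,
      x ∈ Dsc.lang (oracleJoin A O) ↔ x ∈ sipserOrLang (dp k) (oracleJoin A O)} = 0 := by
  obtain ⟨m₁, h0⟩ := measure_forall_correctAt_eq_zero k A Dsc hk
  have hmeas : MeasurableSet {O : Set (List Bool) | ∀ j, O ∈ correctAt k A Dsc (sparse k Dsc m₁ j)} := by
    have : {O : Set (List Bool) | ∀ j, O ∈ correctAt k A Dsc (sparse k Dsc m₁ j)} =
        ⋂ j, correctAt k A Dsc (sparse k Dsc m₁ j) := by
      ext O
      simp
    rw [this]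
    exact MeasurableSet.iInter fun j => measurableSet_correctAt _ _ _ _
  have hsup : acOracleMeasure {O : Set (List Bool) | ∀ j, O ∈ correctAt k A Dsc (sparse k Dsc m₁ j)} = 0 := by
    rw [acOracleMeasure, Measure.map_apply measurable_acOracleOf hmeas]
    exact h0
  have hsub : {O : Set (List Bool) | ∀ x : List Bool,
      x ∈ Dsc.lang (oracleJoin A O) ↔ x ∈ sipserOrLang (dp k) (oracleJoin A O)} ⊆
      {O | ∀ j, O ∈ correctAt k A Dsc (sparse k Dsc m₁ j)} :=
    fun O hO j => hO _
  exact measure_mono_null hsub hsup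

end AcPH

/-! ### Almost surely `Sipser_{k+3} ∘ OR` escapes `Σₖ^{A ⊕ O}`; the discharges -/

/-- **Almost surely `sipserOrLang (k+3) (A ⊕ O) ∉ Σₖ^{A ⊕ O}`** (countable union over the
descriptions of `Σₖ^{A ⊕ O}` languages, each describing the diagonal language with probability
`0`). [cite: AaronsonChen2017, Thm. 5.1 and §5.4 (p. 24)] [cite: RossmanServedioTan2015, §2.3 (p. 7)] -/
theorem ae_sipserOrLang_not_mem_sigmaPRel (k : ℕ) (A : Language Bool) :
    ∀ᵐ (O : Set (List Bool)) ∂acOracleMeasure,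
      sipserOrLang (k + 3) (oracleJoin A O) ∉ SigmaPRel (Oracle.ofLanguage (oracleJoin A O)) k := by
  rw [ae_iff]
  obtain ⟨en, hen⟩ := exists_enum_PHDescr countable_polyTimeOracleAlg_holds
  have hsub : {O : Set (List Bool) |
      ¬ sipserOrLang (k + 3) (oracleJoin A O) ∉ SigmaPRel (Oracle.ofLanguage (oracleJoin A O)) k} ⊆
      ⋃ i, {O | (en i).bounds.length = k ∧ ∀ x : List Bool,
        x ∈ (en i).lang (oracleJoin A O) ↔ x ∈ sipserOrLang (k + 3) (oracleJoin A O)} := by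
    intro O hO
    simp only [not_not, Set.mem_setOf_eq] at hO
    obtain ⟨ps, M, q, hM, hlen, hL⟩ := exists_levelLang_of_mem_sigmaPRel hO
    obtain ⟨i, hi⟩ := hen (show (⟨ps, M, q⟩ : PHDescr) ∈
      {D : PHDescr | D.M.IsPolyTime encodingBoolBool} from hM)
    refine Set.mem_iUnion.2 ⟨i, ?_⟩
    rw [Set.mem_setOf_eq, hi]
    exact ⟨hlen, fun x => by rw [hL]; rfl⟩
  refine measure_mono_null hsub (measure_iUnion_null fun i => ?_)
  by_cases hk : (en i).bounds.length = k
  · exact measure_mono_null (fun O hO => hO.2) (AcPH.acOracleMeasure_lang_eq_zero k A (en i) hk)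
  · have : {O : Set (List Bool) | (en i).bounds.length = k ∧ ∀ x : List Bool,
        x ∈ (en i).lang (oracleJoin A O) ↔ x ∈ sipserOrLang (k + 3) (oracleJoin A O)} = ∅ := by
      ext O
      simp [hk]
    rw [this, measure_empty]

/-- **Discharge of `sipserOrLang_ae_not_mem_sigmaPRel`** (Aaronson–Chen 2017, §5.4: for every `k`
and every left oracle `A`, for `𝒟_O`-almost every `O`, `Sipser_{k+3} ∘ OR` of `A ⊕ O` is not in
`Σₖ^{A ⊕ O}`), from the tree's proof of RST Thm. 1 (`rossmanServedioTan2015_thm1_inRegime_holds`),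
Lemma 5.5 (`lemma55_finite`), the `PH ↦ AC⁰` window circuits (`fSS84_phWindowCircuits_holds`) and
the level structure of `𝒟_O`. [cite: AaronsonChen2017, Thm. 5.1 and §5.4 (Lemma 5.5, p. 24)] -/
theorem sipserOrLang_ae_not_mem_sigmaPRel_holds : sipserOrLang_ae_not_mem_sigmaPRel :=
  fun k A => ae_sipserOrLang_not_mem_sigmaPRel k A

/-- **For every left oracle `A`, `PH^{A ⊕ O}` is infinite for `𝒟_O`-almost every `O`** — closed
form of `ae_isInfinitePHRel_oracleJoin` (both halves discharged). [cite: AaronsonChen2017, Thm. 5.1 (p. 21) and §5.4 (p. 24)] -/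
theorem ae_isInfinitePHRel_oracleJoin_holds (A : Language Bool) :
    ∀ᵐ (O : Set (List Bool)) ∂acOracleMeasure, IsInfinitePHRel (Oracle.ofLanguage (oracleJoin A O)) :=
  ae_isInfinitePHRel_oracleJoin sipserOrLang_mem_PHRel_holds sipserOrLang_ae_not_mem_sigmaPRel_holds A

/-- **Aaronson–Chen 2017, Thm. 5.1, second half — discharge of `aaronsonChen2017_thm51_ph`**:
`PH^{TQBF ⊕ O}` is infinite for `𝒟_O`-almost every `O` (`aaronsonChen2017_thm51_ph_of_parts` with
both halves of the standard connection now theorems: `sipserOrLang_mem_PHRel_holds`,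
`sipserOrLang_ae_not_mem_sigmaPRel_holds`). [cite: AaronsonChen2017, Thm. 5.1 (p. 21) and §5.4 (p. 24)] -/
theorem aaronsonChen2017_thm51_ph_holds : aaronsonChen2017_thm51_ph :=
  aaronsonChen2017_thm51_ph_of_parts sipserOrLang_mem_PHRel_holds sipserOrLang_ae_not_mem_sigmaPRel_holds

end Literature.Barriers.QuantumAdvantage

end
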